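import Mathlib
import HarnessLib
import Summits.ValiantsHypothesis.ValiantsHypothesis.Theorems.LacunarySymmetroidMatrixDescartesProductPlusOneSharpKAnalysis

/-!
# ValiantsHypothesis / LacunarySymmetroid — crux `MatrixDescartes` (stmt-ValiantsHypothesis-18050, V1),
# LINE (A) «product_plus_one»: the SHARP SECTOR for GENERAL `K` — part 3a, GENERIC LEVELS ARE INJECTIVE

**`sharp_level_injective`**: if `f = Σ_{i ≤ K} c_i X^{d_i}` (`K ≥ 1`, `d` strictly increasing, all `c_i ≠ 0`) has `K` distinct
positive zeros (Descartes-sharp) and `μ ∉ {d_i}`, then `θf − μf = X f′ − μ f` cannot vanish at two points `0 < w₁ < w₂` of one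
zero-free interval `[w₁, w₂]` of `f`.  Proof (memo §13; val-v1x-eng-10's level budget made exact): the `K − 1` bounded gaps between
consecutive zeros each carry a zero of `θf − μf` (`exists_euler_root_in_gap`), at most one of which is `w₁` or `w₂`; for an outer
level (`μ < d_0` or `μ > d_K`) one more zero sits in the end component (`sparse_sign_near_zero` / `_top` and the sign of `f′` at
the extreme zero), unless the `w`'s themselves lie there; either way the count exceeds the Descartes budget (`levelBudget_inner` /
`_outer`).  Part 3b turns this into strict monotonicity of `x f′/f`, part 4 into the all-`K` sharp-sector count.

HONEST FRAMING: a per-factor lemma; NOT `stub_classRowK3`, not `stub_polyLaw`, not `ProductPlusOneMDR`, not `MatrixDescartes`, not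
Conjecture B; `VP ≠ VNP` is NOT proved.  No definitions, no named facts; Mathlib + parts 1–2.
-/

-- `Summit.ValiantsHypothesis.ValiantsHypothesis.…` is the tree's mandated single-conjunct layout (Sub = Summit).
set_option linter.dupNamespace false

namespace Summit.ValiantsHypothesis.ValiantsHypothesis.Theorems.LacunarySymmetroidMatrixDescartes

namespace ProductPlusOne

open Polynomial Finset
open scoped BigOperators

/-! ### Coefficients of a sparse sum; non-vanishing of the Euler transforms -/

/-- The coefficient of `X^{d_j}` in `Σ_{i<K} c_i X^{d_i}` is `c_j` (`d` strictly increasing, `j < K`). [folklore] -/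
theorem coeff_sparse (K : ℕ) (d : ℕ → ℕ) (hd : StrictMono d) (c : ℕ → ℝ) (j : ℕ) (hj : j < K) :
    (∑ i ∈ Finset.range K, C (c i) * X ^ (d i) : ℝ[X]).coeff (d j) = c j := by
  rw [finsetSum_coeff, Finset.sum_eq_single j]
  · rw [coeff_C_mul_X_pow, if_pos rfl]
  · intro i _ hij
    rw [coeff_C_mul_X_pow, if_neg (fun h => hij (hd.injective h.symm))]
  · intro h
    exact absurd (Finset.mem_range.mpr hj) h

/-- For `K ≥ 1` and nonzero coefficients, `Σ c_i (d_i − μ) X^{d_i} ≠ 0` for EVERY real `μ`. [folklore] -/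
theorem euler_sparse_ne_zero (K : ℕ) (hK : 1 ≤ K) (d : ℕ → ℕ) (hd : StrictMono d) (c : ℕ → ℝ)
    (hc : ∀ i, i < K + 1 → c i ≠ 0) (μ : ℝ) :
    (∑ i ∈ Finset.range (K + 1), C (c i * ((d i : ℝ) - μ)) * X ^ (d i) : ℝ[X]) ≠ 0 := by
  intro h
  have h0 := coeff_sparse (K + 1) d hd (fun i => c i * ((d i : ℝ) - μ)) 0 (by omega)
  have h1 := coeff_sparse (K + 1) d hd (fun i => c i * ((d i : ℝ) - μ)) 1 (by omega)
  rw [h, coeff_zero] at h0 h1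
  rcases mul_eq_zero.mp h0.symm with h' | h'
  · exact hc 0 (by omega) h'
  rcases mul_eq_zero.mp h1.symm with h'' | h''
  · exact hc 1 (by omega) h''
  have : (d 0 : ℝ) < d 1 := by exact_mod_cast hd (by norm_num : 0 < 1)
  linarith

/-- Trichotomy of a generic level: below `d_0`, above `d_K`, or strictly between two consecutive exponents. [folklore] -/
theorem level_trichotomy (K : ℕ) (d : ℕ → ℕ) (μ : ℝ) (hgen : ∀ i, i < K + 1 → (d i : ℝ) ≠ μ) :
    μ < d 0 ∨ (d K : ℝ) < μ ∨ ∃ i, i < K ∧ (d i : ℝ) < μ ∧ μ < d (i + 1) := by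
  induction K with
  | zero =>
    rcases lt_or_gt_of_ne (hgen 0 (by omega)) with h | h
    · exact Or.inr (Or.inl h)
    · exact Or.inl h
  | succ K ih =>
    rcases ih (fun i hi => hgen i (by omega)) with h | h | ⟨i, hi, h1, h2⟩
    · exact Or.inl h
    · rcases lt_or_gt_of_ne (hgen (K + 1) (by omega)) with h' | h'
      · exact Or.inr (Or.inl h')
      · exact Or.inr (Or.inr ⟨K, by omega, h, h'⟩)
    · exact Or.inr (Or.inr ⟨i, by omega, h1, h2⟩)

/-! ### Injectivity at generic levels -/

/-- **Generic levels are injective per component** (see the module docstring). [this file's theorem] -/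
theorem sharp_level_injective (K : ℕ) (hK : 1 ≤ K) (d : ℕ → ℕ) (hd : StrictMono d) (c : ℕ → ℝ)
    (hc : ∀ i, i < K + 1 → c i ≠ 0)
    (hroots : K ≤ ((∑ i ∈ Finset.range (K + 1), C (c i) * X ^ (d i) : ℝ[X]).roots.toFinset.filter (fun t => 0 < t)).card)
    (μ : ℝ) (hgen : ∀ i, i < K + 1 → (d i : ℝ) ≠ μ) {w₁ w₂ : ℝ} (hw₁ : 0 < w₁) (hw : w₁ < w₂)
    (hfree : ∀ t ∈ Set.Icc w₁ w₂, (∑ i ∈ Finset.range (K + 1), C (c i) * X ^ (d i) : ℝ[X]).eval t ≠ 0)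
    (hg₁ : (X * derivative (∑ i ∈ Finset.range (K + 1), C (c i) * X ^ (d i) : ℝ[X])
      - C μ * ∑ i ∈ Finset.range (K + 1), C (c i) * X ^ (d i)).eval w₁ = 0)
    (hg₂ : (X * derivative (∑ i ∈ Finset.range (K + 1), C (c i) * X ^ (d i) : ℝ[X])
      - C μ * ∑ i ∈ Finset.range (K + 1), C (c i) * X ^ (d i)).eval w₂ = 0) : False := by
  classical
  set f : ℝ[X] := ∑ i ∈ Finset.range (K + 1), C (c i) * X ^ (d i) with hf
  set g : ℝ[X] := X * derivative f - C μ * f with hgdef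
  have hgs : g = ∑ i ∈ Finset.range (K + 1), C (c i * ((d i : ℝ) - μ)) * X ^ (d i) := euler_sparse (K + 1) d c μ
  have hg0 : g ≠ 0 := by rw [hgs]; exact euler_sparse_ne_zero K hK d hd c hc μ
  have hf0 : f ≠ 0 := (sparse_leadingCoeff K d hd c (hc K (by omega))).2
  have hgeval : ∀ t, g.eval t = t * (derivative f).eval t - μ * f.eval t := by
    intro t; rw [hgdef]; simp
  -- the zero set of f on (0,∞), of cardinality exactly K, enumerated increasingly
  set Zf := f.roots.toFinset.filter (fun t => 0 < t) with hZf
  have hV : f.roots.countP (fun t => 0 < t) ≤ K :=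
    (roots_countP_pos_le_signVariations f).trans (signVariations_sparse_le K d hd c hc)
  have hcardK : Zf.card = K := le_antisymm ((StubVLawTwo.card_filter_pos_le_countP f).trans hV) hroots
  have hZmem : ∀ t, t ∈ Zf ↔ 0 < t ∧ f.eval t = 0 := by
    intro t
    rw [hZf, mem_filter, Multiset.mem_toFinset, mem_roots hf0, IsRoot.def]
    tauto
  set z : Fin K ↪o ℝ := Zf.orderEmbOfFin hcardK with hzdef
  have hzmem : ∀ i, z i ∈ Zf := fun i => Finset.orderEmbOfFin_mem Zf hcardK i
  have hzsurj : ∀ t ∈ Zf, ∃ i, z i = t := by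
    intro t ht
    have : t ∈ Set.range (Zf.orderEmbOfFin hcardK) := by rw [Finset.range_orderEmbOfFin]; exact ht
    exact this
  have hzpos : ∀ i, 0 < z i := fun i => ((hZmem _).mp (hzmem i)).1
  have hzroot : ∀ i, f.eval (z i) = 0 := fun i => ((hZmem _).mp (hzmem i)).2
  have hzder : ∀ i, (derivative f).eval (z i) ≠ 0 :=
    fun i => derivative_ne_zero_of_sharp K d hd c hc hroots (hzpos i) (hzroot i)
  have hzle : ∀ i j : Fin K, i.val ≤ j.val → z i ≤ z j := fun i j h => z.le_iff_le.mpr h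
  have hzlt : ∀ i j : Fin K, i.val < j.val → z i < z j := fun i j h => z.lt_iff_lt.mpr h
  -- a zero of f at a positive point is some z l
  have hzof : ∀ t, 0 < t → f.eval t = 0 → ∃ l, z l = t := fun t ht hft => hzsurj t ((hZmem t).mpr ⟨ht, hft⟩)
  -- no zero of f strictly between consecutive z's, below z 0, above z (K-1)
  have hgapfree : ∀ (i j : Fin K), i.val + 1 = j.val → ∀ t ∈ Set.Ioo (z i) (z j), f.eval t ≠ 0 := by
    intro i j hij t ht hft
    obtain ⟨l, hl⟩ := hzof t ((hzpos i).trans ht.1) hft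
    rw [← hl] at ht
    have h1 : i.val < l.val := z.lt_iff_lt.mp ht.1
    have h2 : l.val < j.val := z.lt_iff_lt.mp ht.2
    omega
  set i0 : Fin K := ⟨0, hK⟩ with hi0
  set iK : Fin K := ⟨K - 1, by omega⟩ with hiK
  have hfree0 : ∀ t ∈ Set.Ioo 0 (z i0), f.eval t ≠ 0 := by
    intro t ht hft
    obtain ⟨l, hl⟩ := hzof t ht.1 hft
    have := hzle i0 l (Nat.zero_le _)
    rw [hl] at this
    linarith [ht.2]
  have hfreeK : ∀ B, ∀ t ∈ Set.Ioo (z iK) B, f.eval t ≠ 0 := by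
    intro B t ht hft
    obtain ⟨l, hl⟩ := hzof t ((hzpos iK).trans ht.1) hft
    have := hzle l iK (by simp [hiK]; omega)
    rw [hl] at this
    linarith [ht.1]
  -- the z's avoid [w₁, w₂]
  have hzout : ∀ i, z i < w₁ ∨ w₂ < z i := by
    intro i
    by_contra h
    push Not at h
    exact hfree (z i) ⟨h.1, h.2⟩ (hzroot i)
  -- forced roots of g in the K − 1 bounded gaps
  have hforced : ∀ i : Fin K, ∀ h : i.val + 1 < K, ∃ t ∈ Set.Ioo (z i) (z ⟨i.val + 1, h⟩), g.eval t = 0 := by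
    intro i h
    exact exists_euler_root_in_gap f (hzpos i) (hzlt i ⟨i.val + 1, h⟩ (Nat.lt_succ_self _))
      (hgapfree i ⟨i.val + 1, h⟩ rfl) (hzroot i) (hzroot _) (hzder i) (hzder _) μ
  choose! tf htf using hforced
  -- positive roots of g, and the Descartes bound
  set Zg := g.roots.toFinset.filter (fun t => 0 < t) with hZg
  have hZgmem : ∀ t, 0 < t → g.eval t = 0 → t ∈ Zg := by
    intro t ht hgt
    rw [hZg, mem_filter, Multiset.mem_toFinset, mem_roots hg0, IsRoot.def]
    exact ⟨hgt, ht⟩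
  have hZgcard : Zg.card ≤ g.signVariations :=
    (StubVLawTwo.card_filter_pos_le_countP g).trans (roots_countP_pos_le_signVariations g)
  -- the forced-root set T
  set T : Finset ℝ := (Finset.univ.filter (fun i : Fin K => i.val + 1 < K)).image tf with hT
  have hTmem : ∀ t ∈ T, ∃ i : Fin K, ∃ h : i.val + 1 < K, t = tf i := by
    intro t ht
    rw [hT, Finset.mem_image] at ht
    obtain ⟨i, hi, rfl⟩ := ht
    rw [Finset.mem_filter] at hi
    exact ⟨i, hi.2, rfl⟩
  have hTsub : T ⊆ Zg := by
    intro t ht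
    obtain ⟨i, h, rfl⟩ := hTmem t ht
    obtain ⟨hmem, hroot⟩ := htf i h
    exact hZgmem _ ((hzpos i).trans hmem.1) hroot
  have hTbounds : ∀ t ∈ T, z i0 < t ∧ t < z iK := by
    intro t ht
    obtain ⟨i, h, rfl⟩ := hTmem t ht
    obtain ⟨hmem, _⟩ := htf i h
    have h1 := hzle i0 i (Nat.zero_le _)
    have h2 := hzle ⟨i.val + 1, h⟩ iK (by simp [hiK]; omega)
    exact ⟨by linarith [hmem.1], by linarith [hmem.2]⟩
  have hTcard : T.card = K - 1 := by
    rw [hT, Finset.card_image_of_injOn]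
    · have : (Finset.univ.filter (fun i : Fin K => i.val + 1 < K)) = Finset.univ.filter (fun i : Fin K => i.val < K - 1) := by
        ext i; simp only [Finset.mem_filter, Finset.mem_univ, true_and]; omega
      rw [this, Fin.card_filter_val_lt]
      omega
    · intro i hi j hj hij
      rw [Finset.coe_filter] at hi hj
      have hi' := hi.2
      have hj' := hj.2
      by_contra hne
      obtain ⟨hmi, _⟩ := htf i hi'
      obtain ⟨hmj, _⟩ := htf j hj'
      rw [hij] at hmi
      rcases lt_or_gt_of_ne hne with hlt | hlt
      · have := hzle ⟨i.val + 1, hi'⟩ j (Fin.lt_def.mp hlt)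
        linarith [hmi.2, hmj.1]
      · have := hzle ⟨j.val + 1, hj'⟩ i (Fin.lt_def.mp hlt)
        linarith [hmi.1, hmj.2]
  -- w₁, w₂ are roots of g, not both in T
  have hw₁Z : w₁ ∈ Zg := hZgmem w₁ hw₁ hg₁
  have hw₂Z : w₂ ∈ Zg := hZgmem w₂ (hw₁.trans hw) hg₂
  have hnotboth : ¬ (w₁ ∈ T ∧ w₂ ∈ T) := by
    rintro ⟨h1, h2⟩
    obtain ⟨i, hi, e1⟩ := hTmem w₁ h1
    obtain ⟨j, hj, e2⟩ := hTmem w₂ h2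
    obtain ⟨hmi, _⟩ := htf i hi
    obtain ⟨hmj, _⟩ := htf j hj
    rw [← e1] at hmi
    rw [← e2] at hmj
    rcases lt_trichotomy i.val j.val with hlt | heq | hlt
    · have hle := hzle ⟨i.val + 1, hi⟩ j hlt
      exact hfree (z ⟨i.val + 1, hi⟩) ⟨hmi.2.le, hle.trans hmj.1.le⟩ (hzroot _)
    · have hij : i = j := Fin.ext heq
      subst hij
      have : w₁ = w₂ := by rw [e1, e2]
      linarith
    · have hle := hzle ⟨j.val + 1, hj⟩ i hlt
      linarith [hmi.1, hmj.2]
  -- base count: K ≤ |{w₁, w₂} ∪ T| and, if neither w is in T, K + 1 ≤ it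
  have hsubTw : insert w₁ (insert w₂ T) ⊆ Zg :=
    Finset.insert_subset hw₁Z (Finset.insert_subset hw₂Z hTsub)
  have hbase : K ≤ (insert w₁ (insert w₂ T)).card := by
    by_cases h2 : w₂ ∈ T
    · have h1 : w₁ ∉ insert w₂ T := by
        rw [Finset.mem_insert]
        rintro (h | h)
        · linarith
        · exact hnotboth ⟨h, h2⟩
      rw [Finset.card_insert_of_notMem h1, Finset.insert_eq_of_mem h2, hTcard]
      omega
    · have e : (insert w₂ T).card = K - 1 + 1 := by rw [Finset.card_insert_of_notMem h2, hTcard]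
      have hle : (insert w₂ T).card ≤ (insert w₁ (insert w₂ T)).card := Finset.card_le_card (Finset.subset_insert _ _)
      omega
  have hstrong : w₁ ∉ T → w₂ ∉ T → K + 1 ≤ (insert w₁ (insert w₂ T)).card := by
    intro h1 h2
    have h1' : w₁ ∉ insert w₂ T := by
      rw [Finset.mem_insert]
      rintro (h | h)
      · linarith
      · exact h1 h
    rw [Finset.card_insert_of_notMem h1', Finset.card_insert_of_notMem h2, hTcard]
    omega
  have hcount : (insert w₁ (insert w₂ T)).card ≤ g.signVariations := (Finset.card_le_card hsubTw).trans hZgcard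
  -- budgets by level position
  rcases level_trichotomy K d μ hgen with hμ | hμ | ⟨i, hi, hμ1, hμ2⟩
  · -- OUTER LEFT: V ≤ K
    have hVg : g.signVariations ≤ K := by rw [hgs]; exact levelBudget_outer K d hd c hc μ hgen
    rcases hzout i0 with hz0 | hz0
    · -- z 0 < w₁: an extra root of g in (0, z 0)
      obtain ⟨δ, hδ, hsmall⟩ := sparse_sign_near_zero K d hd (fun i => c i * ((d i : ℝ) - μ))
        (mul_ne_zero (hc 0 (by omega)) (sub_ne_zero.mpr (hgen 0 (by omega))))
      obtain ⟨δf, hδf, hsmallf⟩ := sparse_sign_near_zero K d hd c (hc 0 (by omega))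
      set x₀ := min (z i0) (min δ δf) / 2 with hx₀
      have hm1 : min (z i0) (min δ δf) ≤ z i0 := min_le_left _ _
      have hm2 : min (z i0) (min δ δf) ≤ δ := (min_le_right _ _).trans (min_le_left _ _)
      have hm3 : min (z i0) (min δ δf) ≤ δf := (min_le_right _ _).trans (min_le_right _ _)
      have hmpos : 0 < min (z i0) (min δ δf) := lt_min (hzpos i0) (lt_min hδ hδf)
      have hx₀pos : 0 < x₀ := by rw [hx₀]; linarith
      have hx₀z : x₀ < z i0 := by rw [hx₀]; linarith [hzpos i0]
      have hx₀δ : x₀ < δ := by rw [hx₀]; linarith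
      have hx₀δf : x₀ < δf := by rw [hx₀]; linarith
      have hgx₀ : 0 < c 0 * ((d 0 : ℝ) - μ) * g.eval x₀ := by
        have := hsmall x₀ hx₀pos hx₀δ
        rw [hgs, eval_finsetSum]
        simpa [eval_mul, eval_C, eval_pow, eval_X] using this
      have hfx₀ : 0 < c 0 * f.eval x₀ := by
        have := hsmallf x₀ hx₀pos hx₀δf
        rw [hf, eval_finsetSum]
        simpa [eval_mul, eval_C, eval_pow, eval_X] using this
      have hend := eval_mul_derivative_neg_of_right_end f hfree0 (hzroot i0) (hzder i0) ⟨hx₀pos, hx₀z⟩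
      have hprod : g.eval x₀ * g.eval (z i0) < 0 := by
        rw [hgeval (z i0), hzroot i0, mul_zero, sub_zero]
        have hd0 : 0 < (d 0 : ℝ) - μ := by linarith
        have h1 : 0 < c 0 * g.eval x₀ := by
          have e : c 0 * ((d 0 : ℝ) - μ) * g.eval x₀ = ((d 0 : ℝ) - μ) * (c 0 * g.eval x₀) := by ring
          rw [e] at hgx₀
          exact pos_of_mul_pos_right hgx₀ hd0.le
        -- (c0 g(x₀)) (c0 f(x₀)) (f(x₀) f'(z0)) < 0 ⇒ c0² f(x₀)² g(x₀) f'(z0) < 0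
        have h3 : 0 < (c 0 * f.eval x₀) * (c 0 * f.eval x₀) := mul_pos hfx₀ hfx₀
        have key : (c 0 * g.eval x₀) * (c 0 * f.eval x₀) * (f.eval x₀ * (derivative f).eval (z i0)) < 0 :=
          mul_neg_of_pos_of_neg (mul_pos h1 hfx₀) hend
        have e2 : (c 0 * g.eval x₀) * (c 0 * f.eval x₀) * (f.eval x₀ * (derivative f).eval (z i0))
            = ((c 0 * f.eval x₀) * (c 0 * f.eval x₀)) * (g.eval x₀ * (derivative f).eval (z i0)) := by ring
        rw [e2] at key
        have h4 : g.eval x₀ * (derivative f).eval (z i0) < 0 := by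
          by_contra hcon
          push Not at hcon
          exact absurd key (not_lt.mpr (mul_nonneg h3.le hcon))
        have e3 : g.eval x₀ * (z i0 * (derivative f).eval (z i0)) = z i0 * (g.eval x₀ * (derivative f).eval (z i0)) := by ring
        rw [e3]
        exact mul_neg_of_pos_of_neg (hzpos i0) h4
      obtain ⟨tm, htm, hgtm⟩ := exists_root_of_mul_neg g hx₀z hprod
      have htmZ : tm ∈ Zg := hZgmem tm (hx₀pos.trans htm.1) hgtm
      have htmnew : tm ∉ insert w₁ (insert w₂ T) := by
        intro hmem
        rw [Finset.mem_insert, Finset.mem_insert] at hmem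
        rcases hmem with h | h | h
        · linarith [htm.2]
        · linarith [htm.2]
        · linarith [(hTbounds _ h).1, htm.2]
      have hsub' : insert tm (insert w₁ (insert w₂ T)) ⊆ Zg := Finset.insert_subset htmZ hsubTw
      have hc' := (Finset.card_le_card hsub').trans hZgcard
      rw [Finset.card_insert_of_notMem htmnew] at hc'
      omega
    · -- w₂ < z 0: the w's are not in T
      have h1 : w₁ ∉ T := fun h => by linarith [(hTbounds _ h).1]
      have h2 : w₂ ∉ T := fun h => by linarith [(hTbounds _ h).1]
      have := hstrong h1 h2
      omega
  · -- OUTER RIGHT: V ≤ K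
    have hVg : g.signVariations ≤ K := by rw [hgs]; exact levelBudget_outer K d hd c hc μ hgen
    rcases hzout iK with hzK | hzK
    · -- z (K-1) < w₁ : the w's are not in T
      have h1 : w₁ ∉ T := fun h => by linarith [(hTbounds _ h).2]
      have h2 : w₂ ∉ T := fun h => by linarith [(hTbounds _ h).2]
      have := hstrong h1 h2
      omega
    · -- w₂ < z (K-1): an extra root of g beyond z (K-1)
      obtain ⟨xg, hxgB, hxg⟩ := sparse_sign_near_top K d hd (fun i => c i * ((d i : ℝ) - μ))
        (mul_ne_zero (hc K (by omega)) (sub_ne_zero.mpr (hgen K (by omega)))) (z iK)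
      obtain ⟨xf, hxfB, hxf⟩ := sparse_sign_near_top K d hd c (hc K (by omega)) (z iK)
      have hgxg : 0 < c K * ((d K : ℝ) - μ) * g.eval xg := by
        rw [hgs, eval_finsetSum]
        simpa [eval_mul, eval_C, eval_pow, eval_X] using hxg
      have hfxf : 0 < c K * f.eval xf := by
        rw [hf, eval_finsetSum]
        simpa [eval_mul, eval_C, eval_pow, eval_X] using hxf
      -- sign of f' at the left end z (K-1) of (z_{K-1}, ∞): f(xf) f'(z) > 0
      have hend := eval_mul_derivative_pos_of_left_end f (hfreeK (xf + 1)) (hzroot iK) (hzder iK)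
        (show xf ∈ Set.Ioo (z iK) (xf + 1) from ⟨hxfB, by linarith⟩)
      have hprod : g.eval (z iK) * g.eval xg < 0 := by
        rw [hgeval (z iK), hzroot iK, mul_zero, sub_zero]
        have hdK : (d K : ℝ) - μ < 0 := by linarith
        have h1 : c K * g.eval xg < 0 := by
          have e : c K * ((d K : ℝ) - μ) * g.eval xg = -((-((d K : ℝ) - μ)) * (c K * g.eval xg)) := by ring
          rw [e] at hgxg
          by_contra hcon
          push Not at hcon
          have : 0 ≤ (-((d K : ℝ) - μ)) * (c K * g.eval xg) := mul_nonneg (by linarith) hcon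
          linarith
        have h3 : 0 < (c K * f.eval xf) * (c K * f.eval xf) := mul_pos hfxf hfxf
        have key : (c K * g.eval xg) * (c K * f.eval xf) * (f.eval xf * (derivative f).eval (z iK)) < 0 :=
          mul_neg_of_neg_of_pos (mul_neg_of_neg_of_pos h1 hfxf) hend
        have e2 : (c K * g.eval xg) * (c K * f.eval xf) * (f.eval xf * (derivative f).eval (z iK))
            = ((c K * f.eval xf) * (c K * f.eval xf)) * (g.eval xg * (derivative f).eval (z iK)) := by ring
        rw [e2] at key
        have h4 : g.eval xg * (derivative f).eval (z iK) < 0 := by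
          by_contra hcon
          push Not at hcon
          exact absurd key (not_lt.mpr (mul_nonneg h3.le hcon))
        have e3 : z iK * (derivative f).eval (z iK) * g.eval xg = z iK * (g.eval xg * (derivative f).eval (z iK)) := by ring
        rw [e3]
        exact mul_neg_of_pos_of_neg (hzpos iK) h4
      obtain ⟨tp, htp, hgtp⟩ := exists_root_of_mul_neg g hxgB hprod
      have htpZ : tp ∈ Zg := hZgmem tp ((hzpos iK).trans htp.1) hgtp
      have htpnew : tp ∉ insert w₁ (insert w₂ T) := by
        intro hmem
        rw [Finset.mem_insert, Finset.mem_insert] at hmem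
        rcases hmem with h | h | h
        · linarith [htp.1]
        · linarith [htp.1]
        · linarith [(hTbounds _ h).2, htp.1]
      have hsub' : insert tp (insert w₁ (insert w₂ T)) ⊆ Zg := Finset.insert_subset htpZ hsubTw
      have hc' := (Finset.card_le_card hsub').trans hZgcard
      rw [Finset.card_insert_of_notMem htpnew] at hc'
      omega
  · -- INNER: V ≤ K − 1
    obtain ⟨K', hK'⟩ : ∃ K', K = K' + 1 := ⟨K - 1, by omega⟩
    subst hK'
    have halt : ∀ j, j + 1 < K' + 2 → c j * c (j + 1) < 0 :=
      fun j hj => alternating_of_sharp (K' + 1) d hd c hc hroots j hj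
    have hVg : g.signVariations ≤ K' := by
      rw [hgs]
      exact levelBudget_inner K' d hd c halt μ hgen i (by omega) hμ1 hμ2
    omega

end ProductPlusOne

end Summit.ValiantsHypothesis.ValiantsHypothesis.Theorems.LacunarySymmetroidMatrixDescartes
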